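/-
Copyright: the b2b-balaban T⁴-continuum CRUX team, row NE7b OWNER lineage `t4-ne7b-p1` (gen 123). Project licence.
-/
import Summits.QuantumFields.BalabanUV.T4Continuum.Spine.NE7b.SupTorusFarSourceDecay
import Summits.QuantumFields.BalabanUV.T4Continuum.Spine.NE7b.SupTorusVolumeComparison
import Summits.QuantumFields.BalabanUV.T4Continuum.Spine.NE7b.SupTorusSupNormRoad

/-!
# TWO LEVELS OF THE TOWER OF TORI AGREE NEAR THE CENTRE, EXPONENTIALLY IN THE PERIOD: for data `V, f` on `ℤ^d` (`−λ ≤ V ≤ Λ`, `|f| ≤ M`,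
# NO periodicity, NO support condition) and their window readings `V∘wm_N`, `f∘wm_N` on the fine tori of coarse periods `S` and `S·t`,
# the solutions `u_S`, `u_{St}` of the displayed equations satisfy `|u_{St}(x) − u_S(σ_S(wm_{St} x))| ≤ C·M·e^{δρ_{St}(bt x, 0)}·e^{−δ(S∕2 − 2)}`
# at every site of the larger torus, `(C, δ)` from `(d, a, λ, Λ)` and `C(d)` only, `d ≥ 3` — the two equations, read on the larger torus
# through the covering `x ↦ σ_S(wm_{St} x)` ((158) `action_lift`), have potentials and sources that AGREE on the central window, so (178)
# `far_source_decay` applies to the difference: the Cauchy estimate of the thermodynamic limit (row NE7b, node U5c; (133)∕(152)∕(158)∕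
# (178) + the Literature window kit BY NAME; [folklore])

Cell `pub-balaban`, sub-cell `t4`, spine estimate NE7b (`T4WeightBudget.RelWeightBound`; the cell's OWN estimate — NOT PRINTED in
[Bałaban 1983–89], NOT PROVED).  Crux-route work under `Spine/NE7b/` by the row OWNER (`t4-ne7b-p1` gen 123, file (179)) under FREEZE
(0)'s crux-prover clause; NOTHING of Bałaban's is named as a Lean object, valued or asserted; no `T4Continuum/Support` leaf typed; no `def`,
no notation (the action DISPLAYED; the covering map written out as `σ_S ∘ wm_{St}`); zero `sorry`.  Imports (BY NAME): the OWNER's (178)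
`…SupTorusFarSourceDecay` (`far_source_decay`), (158) `…SupTorusVolumeComparison` (`action_lift`; through it (133) `action_sub`, PTC
`exists_windowMap_siteOf`, `siteOf_add_smul`, `natCast_mul_smul_eq`), (152) `…SupTorusSupNormRoad` (`supNorm_bound_road`), and the
Literature window kit `Beta.InfiniteVolume` (`InWindow`, `windowMap_siteOf`, `inWindow_windowMap`, `inWindow_of_two_mul_abs_lt`).

WHY (located).  § [NE7bP1-G122-HANDOFF] NEXT (3)(c).  The `ℤ^d` propagator is to be `lim_k u_k∘σ_k` along the coarse periods `3^k`, where
`u_k` solves the torus equation with the WINDOW READINGS `V∘wm`, `f∘wm` of the `ℤ^d` data (periodisation of the restriction to the centred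
window — the torus sees `ℤ^d` only through its window).  Two levels `S ∣ St`: the smaller solution read on the larger torus through
`πf = σ_S∘wm_{St}` solves, by (158) `action_lift` (`πf∘σ_{St} = σ_S`), the equation with data `(V∘wm_S)∘πf`, `(f∘wm_S)∘πf`; on the central
window (`wm_{St} x` inside the window of period `(n+1)S`) these EQUAL `V∘wm_{St}`, `f∘wm_{St}` (`wm_S∘σ_S = id` there), so the difference
`w = u_{St} − u_S∘πf` solves `H[V∘wm_{St}]w = g` with `g` supported OFF the central window and `|g| ≤ (2 + 2(|λ| + Λ)C₀)M` ((152)); a block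
within `ρ_{St}`-distance `S∕2 − 2` of the centre lies in the central window (§1, integer bookkeeping of the centred representatives), and
(178) gives the claim.

WHAT IS PROVED ([folklore]; `T_N = Site d ((n+1)N)`, coarse `Site d N`; `wm_N`, `σ_N` the centred window map and the projection; `bt x =
σ(blk n (wm x))`; `ρ_N` the `ℓ¹` circular distance; the action DISPLAYED):
* §1 `abs_le_side_mul` (`q = (n+1)b + r`, `0 ≤ r < n+1` ⟹ `|q| ≤ (n+1)(|b| + 1)`-type bookkeeping), **`inWindow_small_of_blockDist_lt`**
  (`q` in the window of period `(n+1)St` and `ρ_{St}(σ(blk n q), 0) < S∕2 − 2` ⟹ `q` in the window of period `(n+1)S`).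
* §2 `cover_proj` (`σ_S(wm_{St}(σ_{St} q)) = σ_S q`), `window_reading_eq` (on the central window the two readings of `ℤ^d` data agree).
* §3 THE HEADLINE **`tower_comparison`**: `d ≥ 3`, `a > 0`, `λ < min(2,a)`, `Λ ≥ 0` ⟹ `∃ C δ > 0`: for ALL `n, S, t`, ALL `V : ℤ^d → [−λ, Λ]`,
  every `|f| ≤ M` on `ℤ^d`, every solution `u` on `T_S` of the equation with data `V∘wm_S, f∘wm_S` and `U` on `T_{St}` with data
  `V∘wm_{St}, f∘wm_{St}`: `|U x − u(σ_S(wm_{St} x))| ≤ C·M·e^{δρ_{St}(bt x, 0)}·e^{−δ(S∕2 − 2)}` at EVERY `x`.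
* §4 toy (`d = 3`).

HONEST (what this is NOT).  The limit itself is the sequel; `d ≥ 3` only; constants existential and far from sharp; cubic periods;
scalar skeleton ((A3), NC-NE7b-α UNRULED); nothing of the covariant propagators of [B4]–[B6]; nothing of Bałaban's.  BY-NAME EFFECT ON THE
WALL: NONE.  NE7b NOT PRINTED ∕ NOT PROVED; spine PROVED 0∕9; rung (B)+1 on a FINITE torus — NOT infinite volume, NOT the mass gap, NOT
Clay.  HONEST DEPENDENCY: continuum YM on T⁴ ⇐ BetaPertH ∧ nine spine estimates (0∕9 proved); BetaPertH ⇐ (D1) ∧ (D4) ∧ CAP+tail;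
G-an2-4 gates asym, D1 and NE2∕3∕4.
-/

set_option autoImplicit false

noncomputable section

namespace Summit.QuantumFields.BalabanUV.T4Continuum.NE7b.SupTorusTowerComparison

open Real
open Literature.MathematicalPhysics.QuantumFieldTheory.Balaban1983to89
open B6QGQLower276 (X e blk B side side_facts chart mem_B sum_B sum_B_const card_cube blk_chart)
open Beta (Site siteOf windowMap siteOf_windowMap siteOf_add siteOf_sub InWindow windowMap_siteOf inWindow_windowMap
  inWindow_of_two_mul_abs_lt)
open PeriodicSupTorusCarrier (exists_windowMap_siteOf siteOf_add_smul)
open SupTorusBlockDistance (isPseudoDist_torus)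
open SupTorusActionForm (action_sub)
open SupTorusSupNormRoad (supNorm_bound_road)
open SupTorusVolumeComparison (action_lift)
open SupTorusFarSourceDecay (far_source_decay)

variable {d : ℕ}

/-! ## §1. Integer bookkeeping: near blocks of the larger torus lie in the smaller window -/

/-- `q = (n+1)·b + r` with `0 ≤ r < n+1` (`b = blk`): `|q| ≤ (n+1)|b| + r`. [folklore] -/
theorem abs_le_side_mul (n : ℕ) (q : X d) (i : Fin d) :
    |q i| ≤ side n * |blk n q i| + q i % side n ∧ 0 ≤ q i % side n ∧ q i % side n < side n ∧ q i = side n * blk n q i + q i % side n := by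
  have hs : (0 : ℤ) < side n := (side_facts n).1
  have hr0 : 0 ≤ q i % side n := Int.emod_nonneg _ hs.ne'
  have hr1 : q i % side n < side n := Int.emod_lt_of_pos _ hs
  have hq : q i = side n * blk n q i + q i % side n := by
    have := Int.emod_add_mul_ediv (q i) (side n)
    show q i = side n * (q i / side n) + q i % side n
    linarith
  refine ⟨?_, hr0, hr1, hq⟩
  calc |q i| = |side n * blk n q i + q i % side n| := by rw [← hq]
    _ ≤ |side n * blk n q i| + |q i % side n| := abs_add_le _ _
    _ = side n * |blk n q i| + q i % side n := by rw [abs_mul, abs_of_pos hs, abs_of_nonneg hr0]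

/-- **NEAR BLOCKS OF THE LARGER TORUS LIE IN THE SMALLER WINDOW**: if `q ∈ ℤ^d` lies in the centred window of period `(n+1)St` and the block
of `q`, read on the coarse torus of period `St`, is within `ρ_{St}`-distance `S∕2 − 2` of the origin, then `q` lies in the centred window of
period `(n+1)S` — the centred representative `v` of `blk n q i` mod `St` has `2|v| + 4 < S`; `blk n q i − v` is a multiple of `St` and
`|2·blk n q i| ≤ St + 1` (window), so the multiple is zero; then `2|q i| ≤ (n+1)(2|v| + 2) < (n+1)S`. [folklore] -/
theorem inWindow_small_of_blockDist_lt (n S t : ℕ) [NeZero t] (q : X d) (hq : ∀ i, InWindow ((n + 1) * (S * t)) (q i))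
    (hdist : ∑ i, ((((siteOf d (S * t) (blk n q)) i).valMinAbs.natAbs : ℕ) : ℝ) < (S : ℝ) / 2 - 2) (i : Fin d) :
    InWindow ((n + 1) * S) (q i) := by
  classical
  have hs : (0 : ℤ) < side n := (side_facts n).1
  have hside : side n = (n : ℤ) + 1 := rfl
  have ht1 : 1 ≤ t := Nat.pos_of_ne_zero (NeZero.ne t)
  have hNS : (S : ℤ) ≤ ((S * t : ℕ) : ℤ) := by exact_mod_cast Nat.le_mul_of_pos_right S ht1
  set N : ℤ := ((S * t : ℕ) : ℤ) with hN
  have hN0 : 0 ≤ N := by positivity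
  -- the `i`-th term of the distance
  have hterm : ((((siteOf d (S * t) (blk n q)) i).valMinAbs.natAbs : ℕ) : ℝ) < (S : ℝ) / 2 - 2 :=
    lt_of_le_of_lt (Finset.single_le_sum (f := fun j => ((((siteOf d (S * t) (blk n q)) j).valMinAbs.natAbs : ℕ) : ℝ))
      (fun _ _ => Nat.cast_nonneg _) (Finset.mem_univ i)) hdist
  set v : ℤ := ((siteOf d (S * t) (blk n q)) i).valMinAbs with hv
  have hvS : 2 * (v.natAbs : ℤ) + 4 < S := by
    have h1 : 2 * ((v.natAbs : ℕ) : ℝ) + 4 < S := by linarith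
    have h2 : ((2 * v.natAbs + 4 : ℕ) : ℝ) < ((S : ℕ) : ℝ) := by push_cast; exact h1
    have h3 : 2 * v.natAbs + 4 < S := by exact_mod_cast h2
    exact_mod_cast h3
  have hvabs : (v.natAbs : ℤ) = |v| := Int.natCast_natAbs v
  rw [hvabs] at hvS
  -- `blk n q i − v` is a multiple of `St`
  have hcoe : ((v : ZMod (S * t))) = (((blk n q i : ℤ)) : ZMod (S * t)) := by
    rw [hv]; exact ZMod.coe_valMinAbs _
  have hdvd : N ∣ blk n q i - v := (ZMod.intCast_eq_intCast_iff_dvd_sub v (blk n q i) (S * t)).1 hcoe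
  obtain ⟨m, hm⟩ := hdvd
  -- window bookkeeping: `|2·blk n q i| ≤ N + 1`
  obtain ⟨hqabs, hr0, hr1, hqeq⟩ := abs_le_side_mul n q i
  set b : ℤ := blk n q i with hb
  set r : ℤ := q i % side n with hr
  obtain ⟨hw1, hw2⟩ := hq i
  push_cast at hw1 hw2
  have h2b_le : 2 * b ≤ N := by
    have h : side n * (2 * b) ≤ side n * N := by rw [hside, hN]; push_cast; nlinarith
    exact le_of_mul_le_mul_left h hs
  have h2b_ge : -N - 1 ≤ 2 * b := by
    have h : side n * (-N) < side n * (2 * (b + 1)) := by rw [hside, hN]; push_cast; nlinarith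
    have := lt_of_mul_lt_mul_left h hs.le
    linarith
  -- the multiple is zero
  have hm0 : m = 0 := by
    by_contra hm0
    have hm1 : 1 ≤ |m| := Int.one_le_abs hm0
    have hNm : N ≤ |N * m| := by rw [abs_mul, abs_of_nonneg hN0]; exact le_mul_of_one_le_right hN0 hm1
    have hbv : |N * m| ≤ |b| + |v| := by rw [← hm]; exact abs_sub _ _
    have hb2 : |2 * b| ≤ N + 1 := abs_le.2 ⟨by linarith, by linarith⟩
    rw [abs_mul, abs_two] at hb2
    linarith
  rw [hm0, mul_zero, sub_eq_zero] at hm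
  -- `2|q i| < (n+1)S`
  have hb_small : 2 * |b| + 4 < S := by rw [hm]; exact hvS
  refine inWindow_of_two_mul_abs_lt ?_
  push_cast
  have h1 : side n * (2 * |b|) < side n * ((S : ℤ) - 4) := mul_lt_mul_of_pos_left (by linarith) hs
  rw [hside] at h1 hqabs hr1
  nlinarith

/-! ## §2. The covering `σ_S ∘ wm_{St}` and the window readings of `ℤ^d` data -/

/-- **THE COVERING PROJECTS REPRESENTATIVES**: `σ_S(wm_{St}(σ_{St} q)) = σ_S q` on the fine tori (`wm∘σ` moves `q` by a multiple of the large
period `(n+1)St = ((n+1)S)·t`). [folklore] -/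
theorem cover_proj (n S t : ℕ) [NeZero S] [NeZero t] (q : X d) :
    siteOf d ((n + 1) * S) (windowMap d ((n + 1) * (S * t)) (siteOf d ((n + 1) * (S * t)) q)) = siteOf d ((n + 1) * S) q := by
  obtain ⟨m, hm⟩ := exists_windowMap_siteOf ((n + 1) * (S * t)) q
  rw [hm]
  have e : ((((n + 1) * (S * t) : ℕ) : ℤ)) • m = ((((n + 1) * S : ℕ) : ℤ)) • ((t : ℤ) • m) := by
    rw [smul_smul]; congr 1; push_cast; ring
  rw [e, siteOf_add_smul]

/-- **ON THE CENTRAL WINDOW THE TWO READINGS OF `ℤ^d` DATA AGREE**: if `wm_{St} x` lies in the window of period `(n+1)S`, then for every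
`F : ℤ^d → ℝ`, `F(wm_S(σ_S(wm_{St} x))) = F(wm_{St} x)` (`wm_S∘σ_S = id` on the window). [folklore] -/
theorem window_reading_eq (n S t : ℕ) [NeZero S] [NeZero t] (F : X d → ℝ) (x : Site d ((n + 1) * (S * t)))
    (hx : ∀ i, InWindow ((n + 1) * S) (windowMap d ((n + 1) * (S * t)) x i)) :
    F (windowMap d ((n + 1) * S) (siteOf d ((n + 1) * S) (windowMap d ((n + 1) * (S * t)) x))) = F (windowMap d ((n + 1) * (S * t)) x) := by
  rw [windowMap_siteOf d ((n + 1) * S) hx]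

/-! ## §3. THE END: two levels of the tower agree near the centre -/

/-- **HEADLINE — `|u_{St}(x) − u_S(σ_S(wm_{St} x))| ≤ C·M·e^{δρ_{St}(bt x, 0)}·e^{−δ(S∕2 − 2)}` FOR THE WINDOW READINGS OF ANY `ℤ^d` DATA
`V ∈ [−λ, Λ]`, `|f| ≤ M`, ON THE ROAD'S CLASS, `d ≥ 3`, every mesh, every pair of commensurable periods** — `(C, δ)` from `(d, a, λ, Λ)` and
`C(d)` only: (158) `action_lift` for the covering `σ_S∘wm_{St}`, (133) `action_sub`, the central-window agreement of §2, the sup bound (152)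
for the smaller solution, the near-block bookkeeping of §1, and (178) `far_source_decay` with centre `0` and radius `S∕2 − 2`. [folklore] -/
theorem tower_comparison (hd : 3 ≤ d) (a : ℝ) (ha : 0 < a) {lam Lam : ℝ} (hlam : lam < min 2 a) (hLam : 0 ≤ Lam) :
    ∃ C δ : ℝ, 0 < C ∧ 0 < δ ∧ ∀ (n S t : ℕ) [NeZero S] [NeZero t] (V : X d → ℝ), (∀ p, -lam ≤ V p) → (∀ p, V p ≤ Lam) →
      ∀ (M : ℝ) (f : X d → ℝ), (∀ p, |f p| ≤ M) →
      ∀ (u : Site d ((n + 1) * S) → ℝ),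
      (∀ x, ((n : ℝ) + 1) ^ 2 * ∑ μ, (2 * u x - u (x + siteOf d ((n + 1) * S) (e μ)) - u (x - siteOf d ((n + 1) * S) (e μ)))
        + a / ((n : ℝ) + 1) ^ d * ∑ q ∈ B n (blk n (windowMap d ((n + 1) * S) x)), u (siteOf d ((n + 1) * S) q)
        + V (windowMap d ((n + 1) * S) x) * u x = f (windowMap d ((n + 1) * S) x)) →
      ∀ (U : Site d ((n + 1) * (S * t)) → ℝ),
      (∀ x, ((n : ℝ) + 1) ^ 2 * ∑ μ, (2 * U x - U (x + siteOf d ((n + 1) * (S * t)) (e μ)) - U (x - siteOf d ((n + 1) * (S * t)) (e μ)))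
        + a / ((n : ℝ) + 1) ^ d * ∑ q ∈ B n (blk n (windowMap d ((n + 1) * (S * t)) x)), U (siteOf d ((n + 1) * (S * t)) q)
        + V (windowMap d ((n + 1) * (S * t)) x) * U x = f (windowMap d ((n + 1) * (S * t)) x)) →
      ∀ x : Site d ((n + 1) * (S * t)),
        |U x - u (siteOf d ((n + 1) * S) (windowMap d ((n + 1) * (S * t)) x))|
          ≤ C * M * exp (δ * ∑ i, ((((siteOf d (S * t) (blk n (windowMap d ((n + 1) * (S * t)) x))) i).valMinAbs.natAbs : ℕ) : ℝ))
            * exp (-(δ * ((S : ℝ) / 2 - 2))) := by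
  classical
  obtain ⟨C₀, hC₀, H152⟩ := supNorm_bound_road (d := d) hd a ha hlam hLam
  obtain ⟨C₁, δ, hC₁, hδ, H178⟩ := far_source_decay (d := d) hd a ha hlam hLam
  set L : ℝ := |lam| + Lam with hL
  have hL0 : 0 ≤ L := by positivity
  refine ⟨C₁ * (2 + 2 * L * C₀) + 1, δ, by positivity, hδ, ?_⟩
  intro n S t _ _ V hV hV' M f hfM u hu U hU x
  have hM : 0 ≤ M := (abs_nonneg _).trans (hfM 0)
  have hVabs : ∀ p, |V p| ≤ L := fun p => by
    rw [hL, abs_le]; constructor <;> linarith [hV p, hV' p, le_abs_self lam, neg_abs_le lam]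
  -- the covering and its projection property
  set πf : Site d ((n + 1) * (S * t)) → Site d ((n + 1) * S) :=
    fun x' => siteOf d ((n + 1) * S) (windowMap d ((n + 1) * (S * t)) x') with hπf_def
  have hπf : ∀ q : X d, πf (siteOf d ((n + 1) * (S * t)) q) = siteOf d ((n + 1) * S) q := fun q => cover_proj n S t q
  -- the smaller solution is bounded
  have husup : ∀ x', |u x'| ≤ C₀ * M :=
    fun x' => H152 n S (fun x' => V (windowMap d ((n + 1) * S) x')) (fun x' => hV _) (fun x' => hV' _) M u
      (fun x' => f (windowMap d ((n + 1) * S) x')) (fun x' => hfM _) hu x'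
  -- its lift solves the lifted equation ((158) `action_lift`)
  have hlift : ∀ x', ((n : ℝ) + 1) ^ 2 * ∑ μ, (2 * u (πf x') - u (πf (x' + siteOf d ((n + 1) * (S * t)) (e μ)))
        - u (πf (x' - siteOf d ((n + 1) * (S * t)) (e μ))))
      + a / ((n : ℝ) + 1) ^ d * ∑ q ∈ B n (blk n (windowMap d ((n + 1) * (S * t)) x')), u (πf (siteOf d ((n + 1) * (S * t)) q))
      + V (windowMap d ((n + 1) * S) (πf x')) * u (πf x') = f (windowMap d ((n + 1) * S) (πf x')) := fun x' => by
    rw [action_lift n S t πf hπf a u (fun x'' => V (windowMap d ((n + 1) * S) x'')) x']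
    exact hu (πf x')
  -- the difference solves the equation with a source supported off the central window
  set g : Site d ((n + 1) * (S * t)) → ℝ := fun x' =>
    f (windowMap d ((n + 1) * (S * t)) x') - f (windowMap d ((n + 1) * S) (πf x'))
      - (V (windowMap d ((n + 1) * (S * t)) x') - V (windowMap d ((n + 1) * S) (πf x'))) * u (πf x') with hg_def
  have hw : ∀ x', ((n : ℝ) + 1) ^ 2 * ∑ μ, (2 * (U x' - u (πf x')) - (U (x' + siteOf d ((n + 1) * (S * t)) (e μ))
        - u (πf (x' + siteOf d ((n + 1) * (S * t)) (e μ)))) - (U (x' - siteOf d ((n + 1) * (S * t)) (e μ))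
        - u (πf (x' - siteOf d ((n + 1) * (S * t)) (e μ)))))
      + a / ((n : ℝ) + 1) ^ d * ∑ q ∈ B n (blk n (windowMap d ((n + 1) * (S * t)) x')),
        (U (siteOf d ((n + 1) * (S * t)) q) - u (πf (siteOf d ((n + 1) * (S * t)) q)))
      + V (windowMap d ((n + 1) * (S * t)) x') * (U x' - u (πf x')) = g x' := by
    intro x'
    rw [action_sub n a (S * t) (fun x'' => V (windowMap d ((n + 1) * (S * t)) x'')) U (fun x'' => u (πf x'')) x', hU x']
    have h := hlift x'
    simp only [hg_def]
    linarith
  have hgM : ∀ x', |g x'| ≤ (2 + 2 * L * C₀) * M := by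
    intro x'
    have k1 := hfM (windowMap d ((n + 1) * (S * t)) x')
    have k2 := hfM (windowMap d ((n + 1) * S) (πf x'))
    have k3 : |(V (windowMap d ((n + 1) * (S * t)) x') - V (windowMap d ((n + 1) * S) (πf x'))) * u (πf x')| ≤ (L + L) * (C₀ * M) := by
      rw [abs_mul]
      exact mul_le_mul ((abs_sub _ _).trans (add_le_add (hVabs _) (hVabs _))) (husup _) (abs_nonneg _) (by positivity)
    calc |g x'| ≤ |f (windowMap d ((n + 1) * (S * t)) x') - f (windowMap d ((n + 1) * S) (πf x'))|
          + |(V (windowMap d ((n + 1) * (S * t)) x') - V (windowMap d ((n + 1) * S) (πf x'))) * u (πf x')| := abs_sub _ _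
      _ ≤ (|f (windowMap d ((n + 1) * (S * t)) x')| + |f (windowMap d ((n + 1) * S) (πf x'))|) + (L + L) * (C₀ * M) :=
          add_le_add (abs_sub _ _) k3
      _ ≤ (M + M) + (L + L) * (C₀ * M) := by linarith
      _ = (2 + 2 * L * C₀) * M := by ring
  have hg0 : ∀ x', ∑ i, ((((siteOf d (S * t) (blk n (windowMap d ((n + 1) * (S * t)) x'))) i
      - (0 : Site d (S * t)) i).valMinAbs.natAbs : ℕ) : ℝ) < (S : ℝ) / 2 - 2 → g x' = 0 := by
    intro x' hx'
    have hx'' : ∑ i, ((((siteOf d (S * t) (blk n (windowMap d ((n + 1) * (S * t)) x'))) i).valMinAbs.natAbs : ℕ) : ℝ)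
        < (S : ℝ) / 2 - 2 := by simpa only [Pi.zero_apply, sub_zero] using hx'
    have hwin : ∀ i, InWindow ((n + 1) * S) (windowMap d ((n + 1) * (S * t)) x' i) :=
      inWindow_small_of_blockDist_lt n S t (windowMap d ((n + 1) * (S * t)) x') (inWindow_windowMap x') hx''
    simp only [hg_def, hπf_def]
    rw [window_reading_eq n S t f x' hwin, window_reading_eq n S t V x' hwin, sub_self, sub_self, zero_mul, sub_zero]
  -- (178) with centre `0` and radius `S∕2 − 2`
  have h := H178 n (S * t) (fun x'' => V (windowMap d ((n + 1) * (S * t)) x'')) (fun x'' => hV _) (fun x'' => hV' _)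
    (0 : Site d (S * t)) ((S : ℝ) / 2 - 2) ((2 + 2 * L * C₀) * M) (fun x'' => U x'' - u (πf x'')) g hgM hg0 hw x
  simp only [Pi.zero_apply, sub_zero] at h
  refine h.trans ?_
  have hE : 0 ≤ exp (δ * ∑ i, ((((siteOf d (S * t) (blk n (windowMap d ((n + 1) * (S * t)) x))) i).valMinAbs.natAbs : ℕ) : ℝ))
      * exp (-(δ * ((S : ℝ) / 2 - 2))) := by positivity
  calc C₁ * ((2 + 2 * L * C₀) * M)
        * exp (δ * ∑ i, ((((siteOf d (S * t) (blk n (windowMap d ((n + 1) * (S * t)) x))) i).valMinAbs.natAbs : ℕ) : ℝ))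
        * exp (-(δ * ((S : ℝ) / 2 - 2)))
      = (C₁ * (2 + 2 * L * C₀)) * M * (exp (δ * ∑ i, ((((siteOf d (S * t) (blk n (windowMap d ((n + 1) * (S * t)) x))) i).valMinAbs.natAbs
          : ℕ) : ℝ)) * exp (-(δ * ((S : ℝ) / 2 - 2)))) := by ring
    _ ≤ (C₁ * (2 + 2 * L * C₀) + 1) * M * (exp (δ * ∑ i, ((((siteOf d (S * t) (blk n (windowMap d ((n + 1) * (S * t)) x))) i).valMinAbs.natAbs
          : ℕ) : ℝ)) * exp (-(δ * ((S : ℝ) / 2 - 2)))) :=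
        mul_le_mul_of_nonneg_right (mul_le_mul_of_nonneg_right (by linarith) hM) hE
    _ = _ := by ring

/-! ## §4. Toy -/

/-- Toy (`d = 3`, `a = 1`, `λ = 0`, `Λ = 1`): the constants exist. -/
example : ∃ C δ : ℝ, 0 < C ∧ 0 < δ :=
  let ⟨C, δ, hC, hδ, _⟩ := tower_comparison (d := 3) le_rfl 1 one_pos (lam := 0) (Lam := 1)
    (by rw [min_eq_right (by norm_num : (1 : ℝ) ≤ 2)]; norm_num) zero_le_one
  ⟨C, δ, hC, hδ⟩

end Summit.QuantumFields.BalabanUV.T4Continuum.NE7b.SupTorusTowerComparison
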